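import Summits.Langlands.Langlands.Theorems.IrreducibilityBySelfDualityGaloisRepOfRegularAlgebraicGL2CMSuffices
import HarnessLib

/-!
# `GaloisRepGL2CMaeOfLeaves` (route `IrreducibilityBySelfDuality`, item stmt-Langlands-16776), proved

The glue item of the route-choice RE-ROUTE (rchoice 01043479, 2026-08-16) of the Galois input of the
route: the replacement crux `GaloisRepGL2CMae` (stmt-Langlands-16722: Harris–Lan–Taylor–Thorne Thm. A for
`GL₂` over CM fields, almost everywhere) follows from its three finest printed leaves, already filed as
items —

  `HLTTCor627SplitOrUnramified → ACStrongLiftingArchimedean → ACStrongCuspidalBaseChangePrime →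
     GaloisRepGL2CMae`,

i.e. Harris–Lan–Taylor–Thorne 2016 Cor. 6.27 (stmt-Langlands-15020), the archimedean clause of
Arthur–Clozel's strong lifting (stmt-Langlands-15021) and Arthur–Clozel's strong cuspidal base change in
prime degree (stmt-Langlands-15022) — WITHOUT Varma 2024.

## Frame form — why this file does NOT import the route module

When an item closes, the gate links `theorem <Decl>_holds : <Decl> := _root_.<closing theorem>` INTO the
route file, importing the closing module there; a closing module that itself imports the route module is an
import cycle.  So the closing theorem `Summit.Langlands.Langlands.Theorems.GaloisRepGL2CMaeOfLeaves_proof`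
below is stated with the FOUR route decl bodies INLINED VERBATIM (the three leaf item signatures as
antecedents, the crux body as conclusion): its type `δ`-unfolds (four route constants) to the route decl
`Summit.Langlands.Langlands.Theses.IrreducibilityBySelfDuality.GaloisRepGL2CMaeOfLeaves`, and the route
file can import this module without a cycle (imports: the structural module
`…GaloisRepOfRegularAlgebraicGL2CMSuffices` — Literature, `HarnessLib` and landed Theorems modules only).

## Proof

One line: Harris–Lan–Taylor–Thorne's Thm. A (existence, all `n`) follows from the three leaves by the
Literature theorem `HarrisLanTaylorThorne2016.theoremA_existence_of_leaves'` (whose first two hypotheses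
are the named facts `corollary627_splitOrUnramified` and `ArthurClozel1989_strongLifting_archimedean` —
definitionally the first two antecedents here — and whose third hypothesis is the third antecedent
verbatim), and Thm. A (existence) alone gives the `GL₂/CM/a.e.` statement by the landed
`GaloisRepOfRegularAlgebraic.gl2CM_ae_of_theoremA_existence`
(`Theorems/IrreducibilityBySelfDualityGaloisRepOfRegularAlgebraicGL2CMSuffices.lean`).

References: M. Harris, K.-W. Lan, R. Taylor, J. Thorne, Res. Math. Sci. 3:37 (2016), Thm. A, Cor. 6.27,
Thm. 7.13 [HarrisLanTaylorThorneRMS2016]; J. Arthur, L. Clozel, Ann. of Math. Stud. 120 (1989), Ch. 3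
Thms. 4.2, 5.1, Ch. 1 §7 [ArthurClozelAMS120].
-/

noncomputable section

set_option linter.dupNamespace false -- project-wide option (lakefile weak.linter.dupNamespace); `Summit.Langlands.Langlands` is the mandated namespace

namespace Summit.Langlands.Langlands.Theorems

/-- **`GaloisRepGL2CMaeOfLeaves` holds, frame form** (item stmt-Langlands-16776 of route
`IrreducibilityBySelfDuality`): `HLTTCor627SplitOrUnramified → ACStrongLiftingArchimedean →
ACStrongCuspidalBaseChangePrime → GaloisRepGL2CMae`, all four route decl bodies written out verbatim so
that this type `δ`-unfolds to the route decl
`Summit.Langlands.Langlands.Theses.IrreducibilityBySelfDuality.GaloisRepGL2CMaeOfLeaves` (and the route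
file can import this module without a cycle).  Proof: HLTT Cor. 6.27 + Arthur–Clozel's archimedean
clause + strong prime-degree cuspidal base change give HLTT Thm. A (existence) by
`HarrisLanTaylorThorne2016.theoremA_existence_of_leaves'`, and Thm. A (existence) alone gives the
`GL₂/CM/a.e.` form by `GaloisRepOfRegularAlgebraic.gl2CM_ae_of_theoremA_existence`.
[cite: HarrisLanTaylorThorneRMS2016, Thm. A (p. 3), Cor. 6.27 (p. 225), Thm. 7.13 (p. 232)]
[cite: ArthurClozelAMS120, Ch. 3 Thm. 4.2 (a), Thm. 5.1; Ch. 1 §7] -/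
theorem GaloisRepGL2CMaeOfLeaves_proof :
    -- antecedent `HLTTCor627SplitOrUnramified` (route decl body = item stmt-Langlands-15020, verbatim)
    (∀ {n : ℕ} {K : Type} [Field K] [NumberField K] (hcpt : Literature.NumberTheory.Automorphic.isCompact_glFiniteIntegralLevel n K) (p : ℕ) [Fact p.Prime], 1 < n → NumberField.IsCMField K → ∀ (F₀ : IntermediateField ℚ K), Module.finrank ℚ F₀ = 2 ∧ NumberField.IsTotallyComplex F₀ → NumberField.HasTwoPrimesOver F₀ p → ∀ (π : Literature.NumberTheory.Automorphic.CuspidalAutomorphicRepData n K hcpt), π.1.IsRegularAlgebraic → ∀ (ι : PadicAlgCl p ≃+* ℂ), ∃ (N₀ : ℕ) (R : ℕ → Literature.NumberTheory.GaloisRepresentations.FramedGaloisRep K (PadicAlgCl p) (2 * n)) (B : IsDedekindDomain.HeightOneSpectrum (NumberField.RingOfIntegers K) → Multiset (PadicAlgCl p)), (∀ N, N₀ ≤ N → (R N).toGaloisRep.IsSemisimple) ∧ (∀ v, Multiset.card (B v) = n ∧ (0 : PadicAlgCl p) ∉ B v) ∧ ∀ q : ℕ, q.Prime → q ≠ p →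 (NumberField.HasTwoPrimesOver F₀ q ∨ Algebra.IsUnramifiedIn (NumberField.RingOfIntegers K) (Ideal.span {(q : ℤ)})) → π.1.IsUnramifiedAbove q → ∀ v : IsDedekindDomain.HeightOneSpectrum (NumberField.RingOfIntegers K), ((q : ℕ) : NumberField.RingOfIntegers K) ∈ v.asIdeal → ∀ α : Multiset ℂ, π.1.HasSatakeParamAt v α → ∀ N, N₀ ≤ N → (R N).IsUnramifiedAt v ∧ (R N).HasFrobCharpolyAt v (Literature.NumberTheory.Automorphic.arithFrobPolyOfSatake ι v.residueCard n α * ((B v).map fun b => Polynomial.X - Polynomial.C (b * ((v.residueCard : PadicAlgCl p)⁻¹) ^ (2 * N))).prod)) →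
    -- antecedent `ACStrongLiftingArchimedean` (route decl body = item stmt-Langlands-15021, verbatim)
    (∀ (n : ℕ) (F E : Type) [Field F] [NumberField F] [Field E] [NumberField E] [Algebra F E] [IsGalois F E] (hF : Literature.NumberTheory.Automorphic.isCompact_glFiniteIntegralLevel n F) (hE : Literature.NumberTheory.Automorphic.isCompact_glFiniteIntegralLevel n E), IsCyclic (E ≃ₐ[F] E) → (Module.finrank F E).Prime → ∀ (π : Literature.NumberTheory.Automorphic.CuspidalAutomorphicRepData n F hF) (P : Literature.NumberTheory.Automorphic.CuspidalAutomorphicRepData n E hE), Literature.NumberTheory.Automorphic.IsWeakBaseChangeLiftAE π.1 P.1 → ∀ χ : (F →+* ℂ) → Multiset ℂ, π.1.HasArchParameter χ → P.1.HasArchParameter fun τ => χ (τ.comp (algebraMap F E))) →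
    -- antecedent `ACStrongCuspidalBaseChangePrime` (route decl body = item stmt-Langlands-15022, verbatim)
    (∀ (n : ℕ) (F E : Type) [Field F] [NumberField F] [Field E] [NumberField E] [Algebra F E] [IsGalois F E], (Module.finrank F E).Prime → ∀ (hF : Literature.NumberTheory.Automorphic.isCompact_glFiniteIntegralLevel n F) (π : Literature.NumberTheory.Automorphic.CuspidalAutomorphicRepData n F hF), (∃ v : IsDedekindDomain.HeightOneSpectrum (NumberField.RingOfIntegers F), ¬ Algebra.IsUnramifiedIn (NumberField.RingOfIntegers E) v.asIdeal ∧ π.1.IsUnramifiedAt v) → ∀ (hE : Literature.NumberTheory.Automorphic.isCompact_glFiniteIntegralLevel n E), ∃ P : Literature.NumberTheory.Automorphic.CuspidalAutomorphicRepData n E hE, ∀ (w : IsDedekindDomain.HeightOneSpectrum (NumberField.RingOfIntegers E)) (v : IsDedekindDomain.HeightOneSpectrum (NumberField.RingOfIntegers F)) (α : Multiset ℂ), w.asIdeal.under (NumberField.RingOfIntegers F) = v.asIdeal → Algebra.IsUnramifiedIn (NumberField.RingOfIntegers E) v.asIdeal → π.1.HasSatakeParamAt v α → P.1.HasSatakeParamAt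 w (α.map (· ^ w.asIdeal.inertiaDeg (NumberField.RingOfIntegers F)))) →
    -- conclusion `GaloisRepGL2CMae` (route decl body = item stmt-Langlands-16722, verbatim)
    ∀ (K : Type) [Field K] [NumberField K] (hcpt₂ : Literature.NumberTheory.Automorphic.isCompact_glFiniteIntegralLevel 2 K), NumberField.IsCMField K → ∀ (σ : Literature.NumberTheory.Automorphic.CuspidalAutomorphicRepData 2 K hcpt₂), σ.1.IsRegularAlgebraic → ∀ (ℓ : ℕ) [Fact ℓ.Prime] (ι : PadicAlgCl ℓ ≃+* ℂ), ∃ ρ : Literature.NumberTheory.GaloisRepresentations.FramedGaloisRep K (PadicAlgCl ℓ) 2, ∀ᶠ v : IsDedekindDomain.HeightOneSpectrum (NumberField.RingOfIntegers K) in Filter.cofinite, ∀ β : Multiset ℂ, σ.1.HasSatakeParamAt v β → ρ.IsUnramifiedAt v ∧ ρ.HasFrobCharpolyAt v (Literature.NumberTheory.Automorphic.arithFrobPolyOfSatake ι v.residueCard 2 β) :=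
  fun h627 harch hBC =>
    GaloisRepOfRegularAlgebraic.gl2CM_ae_of_theoremA_existence
      (Literature.NumberTheory.Automorphic.HarrisLanTaylorThorne2016.theoremA_existence_of_leaves'
        h627 harch hBC)

end Summit.Langlands.Langlands.Theorems

end
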